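import Summits.QuantumFields.YangMills.Theorems.FluctuationComparisonRegPrIntLS2BetaTreeGaugeChart
import Mathlib.Analysis.SpecialFunctions.Exponential
import Mathlib.Algebra.Order.Chebyshev
import HarnessLib

/-!
# (C3) THE TUBULAR HAAR CHART OF A TREE GAUGE — TRANSVERSAL EDITION (the tree coordinates of the transversal `σ`, and its metric
# transversality: `σ` leaves the base point quadratically in the free-bond coordinates)

Crux `stmt-QuantumFields-20520` (`…Theses.UnitScaleTilt.FluctuationComparisonRegPrIntL`), LINE g18-1 S2β LAPLACE, organ (C3); cell `ym3-torus`
(HUMAN RULING D-0037 — YM₃ on T³ is ladder rung R3, not the Clay problem), width seat `ym3-torus-px21` g10; count-neutral helper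
(`--kind proof --supports stmt-QuantumFields-20520 --as helper`).  Theorems only: 0 `def`, 0 `instance`, 0 `notation`, 0 `sorry`.

WHY.  The Laplace door's transversal-Hessian GROWTH row (w4-20520 g15's v8 `c₁‖y‖² ≤ A(σ y) − A(σ 0)`) reduces by px11 g10's
✓`…S2BetaFibreGrowth.growth_of_offPivot_orbitDist_le` to GAP♯ plus ONE chart-side row (T2) «off-pivot quadratic transversality of the tube»:
the transversal `σ` of the (C3β″) chart leaves the residual ORBIT of `U₀` at rate `≥ c₁‖y‖²` in the off-pivot `dist1²`-distance.  (T2) is a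
property of the tree-gauge tube alone, and THIS file supplies its generic half.  `exists_tubularChart_of_treeGauge_transversal` = the landed
smooth edition ✓`…TreeGaugeChartSmooth.exists_tubularChart_of_treeGauge_smooth` (p739055; same construction `σ y := Ξ (w₀, u₀ · Θ^{β∖F}(eV y))`,
same proof) with THREE MORE ROWS read off the tree coordinates `Ψ = ((g ·)⁻¹|_{ι∖R}, (g(s b) · V b · g(t b)⁻¹)_{b ∉ F})` (part I `psi_xi`):
* (σ-comb) `∀ y, ∀ b ∈ F, σ y b = U₀ b` — the transversal moves no comb bond;
* (σ-transporter) `∀ y, g (σ y) = g U₀` — the transporter is constant along the transversal (`Ψ(σ y).1 = Ψ(U₀).1 = w₀`);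
* (σ-growth) `∃ c > 0, ∀ᶠ y in 𝓝 0, c‖y‖² ≤ Σ_{b ∉ F} ‖ρ((Ψ U₀).2 b)⁻¹ · (Ψ (σ y)).2 b) − 1‖²` — in the free-bond tree coordinates the transversal
  IS the exponential chart, `(Ψ U₀).2⁻¹ · (Ψ (σ y)).2 = Θ^{β∖F}(eV y)`, so the row is `‖e^{X} − 1‖ ≥ ‖X‖∕2` near `X = 0` (`hasFDerivAt_exp_zero`)
  summed over the components of `X = eV y`, with `‖y‖ ≤ ‖eV⁻¹‖·‖eV y‖` and `‖X‖_{sup}² ≤ Σ_b ‖X b‖²`.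
The lattice instance and the passage from `U₀` to its whole residual orbit are this seat's `…TubularChartActTransversal`,
`…SignedCombLipschitz`, `…TubularChartDockTransversal`.  Statement of p739055 untouched (new name, new file).
HONEST SCOPE.  Finite-dimensional group bookkeeping and one-line calculus (`exp` is differentiable at `0`); nothing of Bałaban's analysis;
(T2) ∕ LAPLACE ∕ S2β ∕ stmt-QuantumFields-20520 are NOT proved here; rung R3 = YM₃ on T³ — NOT d = 4, NOT infinite volume, NOT a mass gap, NOT Clay.
[cite: Helgason2000, Ch. I §1 Thm 1.14 (13) p.96; Balaban1985Averaging, (8), (10) p.18; Balaban1985Variational, (19) p.281, Thm 1 (10) p.279]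
-/

noncomputable section

open MeasureTheory MeasureTheory.Measure Set Function Filter Topology
open scoped ENNReal
open Literature.MathematicalPhysics.QuantumFieldTheory.Balaban1983to89
open Literature.MathematicalPhysics.QuantumFieldTheory.Balaban1983to89.HaarExponentialChart
open Literature.MathematicalPhysics.QuantumFieldTheory.Balaban1983to89.LogChartProduct
open Literature.Analysis.Asymptotics

namespace Summit.QuantumFields.YangMills.Theorems.FluctuationComparisonRegPrIntLS2BetaTreeGaugeChartTransversal

open Summit.QuantumFields.YangMills.Theorems.FluctuationComparisonRegPrIntLS2BetaTreeGaugeAlgebra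
open Summit.QuantumFields.YangMills.Theorems.FluctuationComparisonRegPrIntLS2BetaTreeGaugeHaar

/-! ## §0  The free-bond exponential chart leaves `1` at a linear rate (`‖e^X − 1‖ ≥ ‖X‖∕2` near `0`, summed over components) -/

section ExpLower

variable {𝔸 : Type*} [NormedRing 𝔸] [NormedAlgebra ℂ 𝔸] [CompleteSpace 𝔸]
variable (C : LogChart 𝔸) {B : Type*} [Fintype B]
variable {V : Type*} [NormedAddCommGroup V] [NormedSpace ℝ V]

/-- **THE EXPONENTIAL CHART OF `G^B` LEAVES THE IDENTITY AT A LINEAR RATE, IN SQUARE SUM OVER THE COMPONENTS**: for a Euclidean frame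
`eV : V ≃ 𝔤^B` there is `c > 0` with `c‖y‖² ≤ Σ_b ‖exp((eV y)_b) − 1‖²` for all `y` near `0` — because `exp` has derivative `1` at `0`
(`‖e^X − 1 − X‖ ≤ ‖X‖∕2` near `0`, Mathlib `hasFDerivAt_exp_zero`), the sup norm of `𝔤^B ⊂ 𝔸^B` is dominated by the `ℓ²`-sum of the components,
and `‖y‖ ≤ ‖eV⁻¹‖·‖eV y‖`. [cite: Helgason2000, Ch. I §1 Thm 1.14 (13) p.96] -/
theorem exists_sq_norm_le_sum_norm_exp_sub_one_sq (eV : V ≃L[ℝ] (piLogChart C B).lie) :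
    ∃ c : ℝ, 0 < c ∧ ∀ᶠ y in 𝓝 (0 : V),
      c * ‖y‖ ^ 2 ≤ ∑ b : B, ‖NormedSpace.exp (((eV y : (piLogChart C B).lie) : B → 𝔸) b) - 1‖ ^ 2 := by
  -- `‖X‖ ≤ 2‖exp X − 1‖` near `X = 0`
  have hexp : ∀ᶠ X in 𝓝 (0 : 𝔸), ‖X‖ ≤ 2 * ‖NormedSpace.exp X - 1‖ := by
    have h1 := hasFDerivAt_iff_isLittleO_nhds_zero.1 (hasFDerivAt_exp_zero (𝕂 := ℝ) (𝔸 := 𝔸))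
    have h2 := h1.def (by norm_num : (0 : ℝ) < 1 / 2)
    filter_upwards [h2] with X hX
    simp only [zero_add, NormedSpace.exp_zero, one_apply_eq_self] at hX
    have h3 : ‖X‖ ≤ ‖NormedSpace.exp X - 1‖ + ‖NormedSpace.exp X - 1 - X‖ := by
      calc ‖X‖ = ‖(NormedSpace.exp X - 1) - (NormedSpace.exp X - 1 - X)‖ := by congr 1; abel
        _ ≤ ‖NormedSpace.exp X - 1‖ + ‖NormedSpace.exp X - 1 - X‖ := norm_sub_le _ _
    linarith
  -- transport to `y` through the continuous linear components `y ↦ (eV y)_b`, all `b` at once (`B` finite)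
  have hall : ∀ᶠ y in 𝓝 (0 : V), ∀ b : B,
      ‖((eV y : (piLogChart C B).lie) : B → 𝔸) b‖ ≤ 2 * ‖NormedSpace.exp (((eV y : (piLogChart C B).lie) : B → 𝔸) b) - 1‖ := by
    refine Filter.eventually_all.2 fun b => ?_
    have hc : Continuous fun y : V => ((eV y : (piLogChart C B).lie) : B → 𝔸) b :=
      (continuous_apply b).comp (continuous_subtype_val.comp eV.continuous)
    have ht : Tendsto (fun y : V => ((eV y : (piLogChart C B).lie) : B → 𝔸) b) (𝓝 0) (𝓝 0) := by
      simpa using hc.tendsto (0 : V)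
    exact ht.eventually hexp
  set K : ℝ := ‖(eV.symm : (piLogChart C B).lie →L[ℝ] V)‖ with hK
  have hK0 : 0 ≤ K := norm_nonneg (eV.symm : (piLogChart C B).lie →L[ℝ] V)
  refine ⟨1 / (4 * K ^ 2 + 1), by positivity, ?_⟩
  filter_upwards [hall] with y hy
  -- `‖y‖ ≤ K‖eV y‖`
  have hy1 : ‖y‖ ≤ K * ‖(eV y : (piLogChart C B).lie)‖ := by
    have h := (eV.symm : (piLogChart C B).lie →L[ℝ] V).le_opNorm (eV y)
    simpa [hK] using h
  -- `‖eV y‖² ≤ Σ_b ‖(eV y)_b‖²` (sup norm vs. square sum)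
  set X : B → 𝔸 := ((eV y : (piLogChart C B).lie) : B → 𝔸) with hX
  have hX2 : ‖(eV y : (piLogChart C B).lie)‖ ^ 2 ≤ ∑ b : B, ‖X b‖ ^ 2 := by
    have hn : ‖(eV y : (piLogChart C B).lie)‖ = ‖X‖ := rfl
    rw [hn]
    have hsum0 : 0 ≤ ∑ b : B, ‖X b‖ ^ 2 := Finset.sum_nonneg fun b _ => sq_nonneg _
    have hle : ‖X‖ ≤ Real.sqrt (∑ b : B, ‖X b‖ ^ 2) := by
      refine (pi_norm_le_iff_of_nonneg (Real.sqrt_nonneg _)).2 fun b => ?_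
      refine (Real.le_sqrt (norm_nonneg _) hsum0).2 ?_
      exact Finset.single_le_sum (f := fun b => ‖X b‖ ^ 2) (fun b _ => sq_nonneg _) (Finset.mem_univ b)
    calc ‖X‖ ^ 2 ≤ (Real.sqrt (∑ b : B, ‖X b‖ ^ 2)) ^ 2 := pow_le_pow_left₀ (norm_nonneg _) hle 2
      _ = ∑ b : B, ‖X b‖ ^ 2 := Real.sq_sqrt hsum0
  -- `Σ_b ‖X_b‖² ≤ 4 Σ_b ‖exp X_b − 1‖²`
  have hX3 : ∑ b : B, ‖X b‖ ^ 2 ≤ 4 * ∑ b : B, ‖NormedSpace.exp (X b) - 1‖ ^ 2 := by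
    rw [Finset.mul_sum]
    refine Finset.sum_le_sum fun b _ => ?_
    have hb := hy b
    have h0 : 0 ≤ ‖NormedSpace.exp (X b) - 1‖ := norm_nonneg _
    nlinarith [hb, norm_nonneg (X b)]
  set S := ∑ b : B, ‖NormedSpace.exp (X b) - 1‖ ^ 2 with hS
  have hS0 : 0 ≤ S := Finset.sum_nonneg fun b _ => sq_nonneg _
  have hy2 : ‖y‖ ^ 2 ≤ 4 * K ^ 2 * S := by
    calc ‖y‖ ^ 2 ≤ (K * ‖(eV y : (piLogChart C B).lie)‖) ^ 2 := pow_le_pow_left₀ (norm_nonneg _) hy1 2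
      _ = K ^ 2 * ‖(eV y : (piLogChart C B).lie)‖ ^ 2 := by ring
      _ ≤ K ^ 2 * (4 * S) := by gcongr; exact hX2.trans hX3
      _ = 4 * K ^ 2 * S := by ring
  rw [div_mul_eq_mul_div, one_mul, div_le_iff₀ (by positivity)]
  nlinarith [hS0, hy2, sq_nonneg K]

end ExpLower

variable {𝔸 : Type*} [NormedRing 𝔸] [NormedAlgebra ℂ 𝔸] [CompleteSpace 𝔸]
variable {G : Type*} [Group G] [TopologicalSpace G] [IsTopologicalGroup G] [CompactSpace G] [T2Space G]
  [MeasurableSpace G] [BorelSpace G] [SecondCountableTopology G]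
variable {C : LogChart 𝔸} {ρ : G →* 𝔸} (h : IsChartRep C ρ) [FiniteDimensional ℝ C.lie]
  (hlie : ∀ x ∈ C.lie, ∀ y ∈ C.lie, x * y - y * x ∈ C.lie)
variable (μG : Measure G) [μG.IsHaarMeasure] [IsProbabilityMeasure μG]
variable {ι β : Type*} [Fintype ι] [Fintype β]
  (s t : β → ι) (R : Set ι) [DecidablePred (· ∈ R)] (F : Set β) [DecidablePred (· ∈ F)]
  (g : (β → G) → (ι → G))
variable [MeasurableSpace (piLogChart C {x // x ∉ R}).lie] [BorelSpace (piLogChart C {x // x ∉ R}).lie]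
variable [MeasurableSpace (piLogChart C {b // b ∉ F}).lie] [BorelSpace (piLogChart C {b // b ∉ F}).lie]
variable {Z : Type*} [NormedAddCommGroup Z] [InnerProductSpace ℝ Z] [FiniteDimensional ℝ Z] [MeasurableSpace Z] [BorelSpace Z]
  (eZ : Z ≃L[ℝ] (piLogChart C {x // x ∉ R}).lie)
variable {V : Type*} [NormedAddCommGroup V] [InnerProductSpace ℝ V] [FiniteDimensional ℝ V] [MeasurableSpace V] [BorelSpace V]
  (eV : V ≃L[ℝ] (piLogChart C {b // b ∉ F}).lie)

set_option maxHeartbeats 400000 in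
include h hlie eZ eV in
/-- ★★★ **THE TUBULAR HAAR CHART OF A TREE GAUGE — TRANSVERSAL EDITION** (generic assembly; the rows of the smooth edition
✓`exists_tubularChart_of_treeGauge_smooth` plus (σ-comb) `σ y = U₀` on the comb `F`, (σ-transporter) `g (σ y) = g U₀`, and (σ-growth)
`c‖y‖² ≤ Σ_{b ∉ F} ‖ρ((Ψ U₀).2 b⁻¹ · (Ψ (σ y)).2 b) − 1‖²` eventually at `0`, where `(Ψ V).2 b = g V (s b) · V b · g V (t b)⁻¹` are the free-bond tree
coordinates; see the module docstring for the setting and the construction).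
[cite: Helgason2000, Ch. I §1 Thm 1.14 (13) p. 96; HasenpflugRudolfSprungk2024, §3.1 Assumption 3 (T); Balaban1985Averaging, (8), (10) p.18;
Balaban1985Variational, (19) p.281, Thm 1 (10) p.279] -/
theorem exists_tubularChart_of_treeGauge_transversal (hgc : Continuous g) (hgR : ∀ V, ∀ r ∈ R, g V r = 1)
    (hcov : ∀ (a : ι → G), (∀ r ∈ R, a r = 1) → ∀ (V : β → G) (x : ι),
      g (fun b => a (s b) * V b * (a (t b))⁻¹) x = g V x * (a x)⁻¹)
    (hkill : ∀ V, ∀ b ∈ F, g V (s b) * V b * (g V (t b))⁻¹ = 1)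
    (hloc : ∀ V V' : β → G, (∀ b ∈ F, V b = V' b) → g V = g V') (hg1 : g (fun _ => 1) = fun _ => 1)
    (U₀ : β → G) :
    ∃ (e : Z → (ι → G)) (σ : V → (β → G)) (W : Set (Z × V)) (J : Z × V → ℝ),
      Continuous e ∧ e 0 = 1 ∧ (∀ z, ∀ r ∈ R, e z r = 1) ∧
      (∀ sZ ∈ 𝓝 (0 : Z), ∃ tt ∈ 𝓝 (1 : ι → G), ∀ w ∈ tt, (∀ r ∈ R, w r = 1) → w ∈ e '' sZ) ∧
      Continuous σ ∧ σ 0 = U₀ ∧ ContDiff ℝ ⊤ (fun y : V => fun b : β => (ρ (σ y b) : 𝔸)) ∧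
      (∀ y, ∀ b ∈ F, σ y b = U₀ b) ∧ (∀ y, g (σ y) = g U₀) ∧
      (∃ c : ℝ, 0 < c ∧ ∀ᶠ y in 𝓝 (0 : V), c * ‖y‖ ^ 2 ≤
        ∑ b : {b // b ∉ F}, ‖ρ ((g U₀ (s b) * U₀ b * (g U₀ (t b))⁻¹)⁻¹ * (g (σ y) (s b) * σ y b * (g (σ y) (t b))⁻¹)) - 1‖ ^ 2) ∧
      IsOpen W ∧ ((0 : Z), (0 : V)) ∈ W ∧
      InjOn (fun p : Z × V => fun b : β => e p.1 (s b) * σ p.2 b * (e p.1 (t b))⁻¹) W ∧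
      (∀ sW ∈ 𝓝 ((0 : Z), (0 : V)), (fun p : Z × V => fun b : β => e p.1 (s b) * σ p.2 b * (e p.1 (t b))⁻¹) '' sW ∈ 𝓝 U₀) ∧
      ContinuousOn J W ∧ (∀ w ∈ W, 0 ≤ J w) ∧ 0 < J (0, 0) ∧
      (Measure.pi fun _ : β => μG).restrict ((fun p : Z × V => fun b : β => e p.1 (s b) * σ p.2 b * (e p.1 (t b))⁻¹) '' W) =
        ((((volume : Measure Z).prod (volume : Measure V)).restrict W).withDensity (fun w => ENNReal.ofReal (J w))).map
          (fun p : Z × V => fun b : β => e p.1 (s b) * σ p.2 b * (e p.1 (t b))⁻¹) := by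
  classical
  haveI := finiteDimensional_piLogChart_lie C {x // x ∉ R}
  haveI := finiteDimensional_piLogChart_lie C {b // b ∉ F}
  -- the two factor groups, their Haar measures and framed exponential charts
  set hR := isChartRep_pi {x // x ∉ R} h with hhR
  set hF := isChartRep_pi {b // b ∉ F} h with hhF
  set νR : Measure ({x // x ∉ R} → G) := Measure.pi fun _ => μG with hνR
  set νF : Measure ({b // b ∉ F} → G) := Measure.pi fun _ => μG with hνF
  obtain ⟨UZ, dZ, hUZo, h0Z, hinjZ, hdZc, hdZ0, hdZpos, -, hchartZ⟩ :=
    exists_haarChart_expChart_frame hR (lie_adStable_pi C {x // x ∉ R} hlie) νR eZ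
  obtain ⟨UV, dV, hUVo, h0V, hinjV, hdVc, hdV0, hdVpos, -, hchartV⟩ :=
    exists_haarChart_expChart_frame hF (lie_adStable_pi C {b // b ∉ F} hlie) νF eV
  set τZ : Z → ({x // x ∉ R} → G) := fun z => hR.expChart (eZ z) with hτZ
  set τV : V → ({b // b ∉ F} → G) := fun y => hF.expChart (eV y) with hτV
  have hτZc : Continuous τZ := hR.continuous_expChart.comp eZ.continuous
  have hτVc : Continuous τV := hF.continuous_expChart.comp eV.continuous
  have hτZ0 : τZ 0 = 1 := by simp only [hτZ, map_zero, IsChartRep.expChart_zero]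
  have hτV0 : τV 0 = 1 := by simp only [hτV, map_zero, IsChartRep.expChart_zero]
  -- the tree-gauge maps
  set Ξ : ({x // x ∉ R} → G) × ({b // b ∉ F} → G) → (β → G) := fun p => fun b : β =>
      (fun x : ι => if hx : x ∈ R then (1 : G) else p.1 ⟨x, hx⟩) (s b) *
        (fun b : β => if hb : b ∈ F then (1 : G) else p.2 ⟨b, hb⟩) b *
        ((fun x : ι => if hx : x ∈ R then (1 : G) else p.1 ⟨x, hx⟩) (t b))⁻¹ with hΞ_def
  set Ψ : (β → G) → ({x // x ∉ R} → G) × ({b // b ∉ F} → G) := fun V =>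
    ((fun x : {x // x ∉ R} => (g V x)⁻¹), (fun b : {b // b ∉ F} => g V (s b) * V b * (g V (t b))⁻¹)) with hΨ_def
  have hΞΨ : ∀ V, Ξ (Ψ V) = V := fun V => xi_psi s t R F g hgR hkill V
  have hΨΞ : ∀ p, Ψ (Ξ p) = p := fun p => psi_xi s t R F g hcov hloc hg1 p.1 p.2
  have hΞc : Continuous Ξ := continuous_xi (G := G) s t R F
  have hΞmp : MeasurePreserving Ξ (νR.prod νF) (Measure.pi fun _ : β => μG) :=
    measurePreserving_xi μG s t R F g hgc.measurable hgR hcov hkill hloc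
  -- `Ξ` is a homeomorphism (continuous bijection, compact → Hausdorff)
  set ΞE : (({x // x ∉ R} → G) × ({b // b ∉ F} → G)) ≃ (β → G) :=
    { toFun := Ξ, invFun := Ψ, left_inv := hΨΞ, right_inv := hΞΨ } with hΞE
  set ΞH : (({x // x ∉ R} → G) × ({b // b ∉ F} → G)) ≃ₜ (β → G) := Continuous.homeoOfEquivCompactToT2 (f := ΞE) hΞc with hΞH
  have hΞH_apply : ∀ p, ΞH p = Ξ p := fun p => rfl
  -- the base point in tree coordinates
  set w₀ : {x // x ∉ R} → G := (Ψ U₀).1 with hw₀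
  set u₀ : {b // b ∉ F} → G := (Ψ U₀).2 with hu₀
  have hq₀ : Ψ U₀ = (w₀, u₀) := rfl
  -- the chart maps
  set ext : ({x // x ∉ R} → G) → (ι → G) := fun w x => if hx : x ∈ R then (1 : G) else w ⟨x, hx⟩ with hext
  have hext_mul : ∀ w w' : {x // x ∉ R} → G, ext (w * w') = ext w * ext w' := by
    intro w w'; funext x; by_cases hx : x ∈ R <;> simp [hext, hx]
  have hext_one : ext 1 = 1 := by funext x; by_cases hx : x ∈ R <;> simp [hext, hx]
  have hext_R : ∀ w, ∀ r ∈ R, ext w r = 1 := fun w r hr => by simp [hext, hr]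
  have hextc : Continuous ext := by
    refine continuous_pi fun x => ?_
    by_cases hx : x ∈ R
    · simp only [hext, dif_pos hx]; exact continuous_const
    · simp only [hext, dif_neg hx]; exact continuous_apply _
  set e : Z → (ι → G) := fun z => ext w₀ * ext (τZ z) * (ext w₀)⁻¹ with he_def
  set σ : V → (β → G) := fun y => Ξ (w₀, u₀ * τV y) with hσ_def
  set Θ' : Z × V → (β → G) := fun p => fun b : β => e p.1 (s b) * σ p.2 b * (e p.1 (t b))⁻¹ with hΘ'_def
  -- KEY IDENTITY: `Θ' = Ξ ∘ ((w₀,u₀) · ) ∘ (τZ × τV)`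
  have hkey : ∀ p : Z × V, Θ' p = Ξ ((w₀, u₀) * (τZ p.1, τV p.2)) := by
    intro p
    funext b
    simp only [hΘ'_def, he_def, hσ_def, hΞ_def, Prod.mk_mul_mk, Pi.mul_apply, Pi.inv_apply, hext]
    by_cases hs : s b ∈ R <;> by_cases ht : t b ∈ R <;> by_cases hb : b ∈ F
    all_goals simp [hs, ht, hb]
    all_goals group
  -- the window and the density
  set W : Set (Z × V) := UZ ×ˢ UV with hW
  set J : Z × V → ℝ := fun p => dZ p.1 * dV p.2 with hJ
  refine ⟨e, σ, W, J, ?_, ?_, ?_, ?_, ?_, ?_, ?_, ?_, ?_, ?_, hUZo.prod hUVo, ⟨h0Z, h0V⟩, ?_, ?_, ?_, ?_, ?_, ?_⟩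
  · -- `e` continuous
    exact ((continuous_const.mul (hextc.comp hτZc)).mul continuous_const)
  · -- `e 0 = 1`
    simp only [he_def, hτZ0, hext_one, mul_one, mul_inv_cancel]
  · -- root-trivial
    intro z r hr
    simp only [he_def, Pi.mul_apply, Pi.inv_apply, hext_R _ r hr, mul_one, mul_inv_cancel]
  · -- `e` is onto a neighbourhood of `1` among the root-trivial transformations
    intro sZ hsZ
    have h1 : τZ '' sZ ∈ 𝓝 (1 : {x // x ∉ R} → G) :=
      nhds_one_le_map_expChart_frame hR eZ (Filter.image_mem_map hsZ)
    -- conjugate by `w₀` and pull back along the restriction map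
    set cj : ({x // x ∉ R} → G) ≃ₜ ({x // x ∉ R} → G) := (Homeomorph.mulLeft w₀).trans (Homeomorph.mulRight w₀⁻¹) with hcj
    have hc1 : cj 1 = 1 := by
      simp only [hcj, Homeomorph.trans_apply, Homeomorph.coe_mulLeft, Homeomorph.coe_mulRight, mul_one, mul_inv_cancel]
    have h2 : cj '' (τZ '' sZ) ∈ 𝓝 (1 : {x // x ∉ R} → G) := by
      have := cj.isOpenMap.image_mem_nhds h1
      rwa [hc1] at this
    set rest : (ι → G) → ({x // x ∉ R} → G) := fun w x => w x with hrest
    have hrestc : Continuous rest := continuous_pi fun x => continuous_apply _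
    have hrest1 : rest 1 = 1 := rfl
    refine ⟨rest ⁻¹' (cj '' (τZ '' sZ)), hrestc.continuousAt.preimage_mem_nhds (by rw [hrest1]; exact h2), ?_⟩
    intro w hw hwR
    obtain ⟨v, ⟨z, hz, rfl⟩, hv⟩ := hw
    refine ⟨z, hz, ?_⟩
    funext x
    by_cases hx : x ∈ R
    · simp only [he_def, Pi.mul_apply, Pi.inv_apply, hext_R _ x hx, mul_one, mul_inv_cancel, hwR x hx]
    · have hvx := congrFun hv ⟨x, hx⟩
      simp only [hcj, Homeomorph.trans_apply, Homeomorph.coe_mulLeft, Homeomorph.coe_mulRight, hrest] at hvx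
      simp only [he_def, Pi.mul_apply, Pi.inv_apply, hext, dif_neg hx]
      simpa using hvx
  · -- `σ` continuous
    exact hΞc.comp (continuous_const.prodMk (continuous_const.mul hτVc))
  · -- `σ 0 = U₀`
    simp only [hσ_def, hτV0, mul_one]
    rw [← hq₀]; exact hΞΨ U₀
  · -- `σ` is smooth through `ρ`: bondwise `const · exp(linear) · const` in `𝔸`
    have hexp : ContDiff ℝ ⊤ (NormedSpace.exp : 𝔸 → 𝔸) :=
      contDiff_iff_contDiffAt.2 fun x => (NormedSpace.exp_analytic (𝕂 := ℝ) x).contDiffAt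
    refine contDiff_pi.2 fun b => ?_
    have hσb : ∀ y : V, ρ (σ y b) = ρ (ext w₀ (s b)) *
        ρ ((fun b : β => if hb : b ∈ F then (1 : G) else (u₀ * τV y) ⟨b, hb⟩) b) * ρ ((ext w₀ (t b))⁻¹) := by
      intro y; simp only [hσ_def, hΞ_def, hext, map_mul]
    rw [show (fun y : V => ρ (σ y b)) = fun y => ρ (ext w₀ (s b)) *
        ρ ((fun b : β => if hb : b ∈ F then (1 : G) else (u₀ * τV y) ⟨b, hb⟩) b) * ρ ((ext w₀ (t b))⁻¹) from funext hσb]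
    refine (contDiff_const.mul ?_).mul contDiff_const
    by_cases hb : b ∈ F
    · simp only [dif_pos hb, map_one]; exact contDiff_const
    · simp only [dif_neg hb, Pi.mul_apply, map_mul]
      refine contDiff_const.mul ?_
      -- `ρ (τV y ⟨b, hb⟩) = exp (a linear function of y)`
      set L : V →ₗ[ℝ] 𝔸 := C.lie.subtype ∘ₗ (LinearMap.proj (R := ℝ) (φ := fun _ : {b // b ∉ F} => C.lie) ⟨b, hb⟩ ∘ₗ
        ((lieEquivPi C {b // b ∉ F}).toLinearMap ∘ₗ (eV : V ≃L[ℝ] (piLogChart C {b // b ∉ F}).lie).toLinearEquiv.toLinearMap)) with hL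
      have hρτ : (fun y : V => ρ (τV y ⟨b, hb⟩)) = fun y => NormedSpace.exp (LinearMap.toContinuousLinearMap L y) := by
        funext y
        show ρ ((isChartRep_pi {b // b ∉ F} h).expChart (eV y) ⟨b, hb⟩) = _
        rw [expChart_pi_apply (B := {b // b ∉ F}) h, h.rho_expChart]
        rfl
      rw [hρτ]
      exact hexp.comp (LinearMap.toContinuousLinearMap L).contDiff
  · -- (σ-comb) the transversal moves no comb bond
    intro y b hb
    have hU₀ : Ξ (w₀, u₀) = U₀ := by rw [← hq₀]; exact hΞΨ U₀
    rw [← congrFun hU₀ b]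
    simp only [hσ_def, hΞ_def, dif_pos hb]
  · -- (σ-transporter) the transporter is constant along the transversal: `Ψ(σ y).1 = w₀ = Ψ(U₀).1`
    intro y
    have hΨσ : Ψ (σ y) = (w₀, u₀ * τV y) := hΨΞ (w₀, u₀ * τV y)
    funext x
    by_cases hx : x ∈ R
    · rw [hgR _ x hx, hgR _ x hx]
    · have h1 : (g (σ y) x)⁻¹ = w₀ ⟨x, hx⟩ := by
        have := congrFun (congrArg Prod.fst hΨσ) ⟨x, hx⟩
        simpa only [hΨ_def] using this
      have h2 : (g U₀ x)⁻¹ = w₀ ⟨x, hx⟩ := rfl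
      exact inv_injective (h1.trans h2.symm)
  · -- (σ-growth) in the free-bond tree coordinates the transversal IS the exponential chart: `(Ψ U₀).2⁻¹ · (Ψ (σ y)).2 = Θ^{β∖F}(eV y)`
    obtain ⟨c, hc, hev⟩ := exists_sq_norm_le_sum_norm_exp_sub_one_sq C eV
    refine ⟨c, hc, ?_⟩
    filter_upwards [hev] with y hy
    have hΨσ : Ψ (σ y) = (w₀, u₀ * τV y) := hΨΞ (w₀, u₀ * τV y)
    have hterm : ∀ b : {b // b ∉ F},
        ρ ((g U₀ (s b) * U₀ b * (g U₀ (t b))⁻¹)⁻¹ * (g (σ y) (s b) * σ y b * (g (σ y) (t b))⁻¹)) =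
          NormedSpace.exp (((eV y : (piLogChart C {b // b ∉ F}).lie) : {b // b ∉ F} → 𝔸) b) := by
      intro b
      have h1 : g (σ y) (s b) * σ y b * (g (σ y) (t b))⁻¹ = u₀ b * τV y b := by
        have := congrFun (congrArg Prod.snd hΨσ) b
        simpa only [hΨ_def, Pi.mul_apply] using this
      have h2 : g U₀ (s b) * U₀ b * (g U₀ (t b))⁻¹ = u₀ b := rfl
      rw [h1, h2, ← mul_assoc, inv_mul_cancel, one_mul]
      show ρ ((isChartRep_pi {b // b ∉ F} h).expChart (eV y) b) = _
      rw [expChart_pi_apply (B := {b // b ∉ F}) h, h.rho_expChart]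
      rfl
    calc c * ‖y‖ ^ 2 ≤ _ := hy
      _ = _ := Finset.sum_congr rfl fun b _ => by rw [hterm b]
  · -- injectivity on the window
    intro p hp p' hp' hpp
    have h1 : Ξ ((w₀, u₀) * (τZ p.1, τV p.2)) = Ξ ((w₀, u₀) * (τZ p'.1, τV p'.2)) := by
      rw [← hkey, ← hkey]; exact hpp
    have h2 := mul_left_cancel (ΞE.injective h1)
    simp only [Prod.mk.injEq] at h2
    exact Prod.ext (hinjZ hp.1 hp'.1 h2.1) (hinjV hp.2 hp'.2 h2.2)
  · -- openness at the origin
    intro sW hsW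
    have hτ : (fun p : Z × V => (τZ p.1, τV p.2)) '' sW ∈ 𝓝 ((1 : {x // x ∉ R} → G), (1 : {b // b ∉ F} → G)) := by
      have hle : 𝓝 ((1 : {x // x ∉ R} → G), (1 : {b // b ∉ F} → G)) ≤
          map (fun p : Z × V => (τZ p.1, τV p.2)) (𝓝 ((0 : Z), (0 : V))) := by
        rw [nhds_prod_eq, nhds_prod_eq, ← Filter.prod_map_map_eq]
        exact Filter.prod_mono (nhds_one_le_map_expChart_frame hR eZ) (nhds_one_le_map_expChart_frame hF eV)
      exact hle (Filter.image_mem_map hsW)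
    have hL : (fun q => (w₀, u₀) * q) '' ((fun p : Z × V => (τZ p.1, τV p.2)) '' sW) ∈ 𝓝 ((w₀, u₀) : ({x // x ∉ R} → G) × ({b // b ∉ F} → G)) := by
      have := (Homeomorph.mulLeft ((w₀, u₀) : ({x // x ∉ R} → G) × ({b // b ∉ F} → G))).isOpenMap.image_mem_nhds hτ
      simpa using this
    have hΞo : Ξ '' ((fun q => (w₀, u₀) * q) '' ((fun p : Z × V => (τZ p.1, τV p.2)) '' sW)) ∈ 𝓝 (Ξ (w₀, u₀)) := by
      have := ΞH.isOpenMap.image_mem_nhds hL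
      simpa [hΞH_apply] using this
    have hU₀ : Ξ (w₀, u₀) = U₀ := by rw [← hq₀]; exact hΞΨ U₀
    rw [hU₀] at hΞo
    refine Filter.mem_of_superset hΞo ?_
    rintro _ ⟨_, ⟨_, ⟨p, hp, rfl⟩, rfl⟩, rfl⟩
    exact ⟨p, hp, hkey p⟩
  · -- `J` continuous on `W`
    exact ((hdZc.comp continuous_fst).mul (hdVc.comp continuous_snd)).continuousOn
  · exact fun w _ => mul_nonneg (hdZ0 _) (hdV0 _)
  · exact mul_pos hdZpos hdVpos
  · -- THE CHART IDENTITY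
    haveI : (νR.prod νF).IsMulLeftInvariant := inferInstance
    -- (1) the product of the two frame charts
    have hτm : Measurable (fun p : Z × V => (τZ p.1, τV p.2)) := (hτZc.prodMap hτVc).measurable
    have hdZm : Measurable fun z => ENNReal.ofReal (dZ z) := ENNReal.measurable_ofReal.comp hdZc.measurable
    have hdVm : Measurable fun y => ENNReal.ofReal (dV y) := ENNReal.measurable_ofReal.comp hdVc.measurable
    have hprod : (νR.prod νF).restrict ((fun p : Z × V => (τZ p.1, τV p.2)) '' W) =
        ((((volume : Measure Z).prod (volume : Measure V)).restrict W).withDensity (fun w => ENNReal.ofReal (J w))).map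
          (fun p : Z × V => (τZ p.1, τV p.2)) := by
      have himg : (fun p : Z × V => (τZ p.1, τV p.2)) '' W = (τZ '' UZ) ×ˢ (τV '' UV) := by
        rw [hW]; exact Set.prodMap_image_prod τZ τV UZ UV
      rw [himg, ← Measure.prod_restrict, hchartZ, hchartV,
        Measure.map_prod_map _ _ hτZc.measurable hτVc.measurable,
        prod_withDensity hdZm hdVm, Measure.prod_restrict, ← hW]
      congr 1
      refine withDensity_congr_ae (Filter.Eventually.of_forall fun p => ?_)
      simp only [hJ]
      rw [ENNReal.ofReal_mul (hdZ0 _)]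
    -- (2) left translation in the product group is Haar-preserving and a measurable embedding
    have hLmp : MeasurePreserving (fun q => ((w₀, u₀) : ({x // x ∉ R} → G) × ({b // b ∉ F} → G)) * q) (νR.prod νF) (νR.prod νF) :=
      measurePreserving_mul_left _ _
    have hLemb : MeasurableEmbedding (fun q => ((w₀, u₀) : ({x // x ∉ R} → G) × ({b // b ∉ F} → G)) * q) :=
      (Homeomorph.mulLeft ((w₀, u₀) : ({x // x ∉ R} → G) × ({b // b ∉ F} → G))).measurableEmbedding
    have hL := (hLmp.restrict_image_emb hLemb ((fun p : Z × V => (τZ p.1, τV p.2)) '' W)).map_eq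
    -- (3) `Ξ` is measure preserving and a measurable embedding (homeomorphism)
    have hΞemb : MeasurableEmbedding Ξ := by
      have hco : (ΞH : (({x // x ∉ R} → G) × ({b // b ∉ F} → G)) → (β → G)) = Ξ := funext hΞH_apply
      rw [← hco]
      exact ΞH.measurableEmbedding
    have hX := (hΞmp.restrict_image_emb hΞemb
      ((fun q => ((w₀, u₀) : ({x // x ∉ R} → G) × ({b // b ∉ F} → G)) * q) '' ((fun p : Z × V => (τZ p.1, τV p.2)) '' W))).map_eq
    -- assemble
    have hΘ'eq : Θ' = Ξ ∘ (fun q => ((w₀, u₀) : ({x // x ∉ R} → G) × ({b // b ∉ F} → G)) * q) ∘ (fun p : Z × V => (τZ p.1, τV p.2)) := by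
      funext p; exact hkey p
    have himg3 : Θ' '' W = Ξ '' ((fun q => ((w₀, u₀) : ({x // x ∉ R} → G) × ({b // b ∉ F} → G)) * q) '' ((fun p : Z × V => (τZ p.1, τV p.2)) '' W)) := by
      rw [hΘ'eq, Set.image_comp, Set.image_comp]
    show (Measure.pi fun _ : β => μG).restrict (Θ' '' W) =
      ((((volume : Measure Z).prod (volume : Measure V)).restrict W).withDensity (fun w => ENNReal.ofReal (J w))).map Θ'
    rw [himg3, ← hX, ← hL, hprod, Measure.map_map hLemb.measurable hτm, Measure.map_map hΞemb.measurable (hLemb.measurable.comp hτm), hΘ'eq]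

end Summit.QuantumFields.YangMills.Theorems.FluctuationComparisonRegPrIntLS2BetaTreeGaugeChartTransversal

end
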